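import Summits.CriticalPhenomena.CardyFormulaZ2.Theorems.CardyBoundaryCoulombGasStripClusterRatesConfinedOfPlain
import Summits.CriticalPhenomena.CardyFormulaZ2.Theorems.CardyBoundaryCoulombGasStripClusterRatesRateConfined
import Summits.CriticalPhenomena.CardyFormulaZ2.Theorems.CardyBoundaryCoulombGasStripClusterRatesConfinedUpperOfKacTwo
import Summits.CriticalPhenomena.CardyFormulaZ2.Theorems.CardyBoundaryCoulombGasStripClusterRatesQuasiMultOfSep
import Summits.CriticalPhenomena.CardyFormulaZ2.Theorems.CardyBoundaryCoulombGasStripClusterRatesConfinedLowerOfSepKacTwo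
import Summits.CriticalPhenomena.CardyFormulaZ2.Theorems.CardyBoundaryCoulombGasStripClusterRatesUniformUpperOfSep
import Summits.CriticalPhenomena.CardyFormulaZ2.Theorems.CardyBoundaryCoulombGasStripClusterRatesKacTwoOfSepPlain
import Summits.CriticalPhenomena.CardyFormulaZ2.Theorems.CardyBoundaryCoulombGasStripClusterRatesPlainUpperOfUniformKacTwo
import Summits.CriticalPhenomena.CardyFormulaZ2.Theorems.CardyBoundaryCoulombGasStripClusterRatesConfinedAprioriLower
import Summits.CriticalPhenomena.CardyFormulaZ2.Theorems.CardyBoundaryCoulombGasStripClusterRatesCardyOrderTransfer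
import Summits.CriticalPhenomena.CardyFormulaZ2.Theorems.CardyBoundaryCoulombGasStripClusterRatesTwoClusterKacIffKacTwo
import HarnessLib

/-!
# The end-separation package: what arm separation at the strip ends buys for crux `StripClusterRates`

Support file for line `two-cluster-rate-is-stationary-gap` of crux `CardyBoundaryCoulombGas.StripClusterRates`
(stmt-CriticalPhenomena-13878), lead c8. Objects: `p₂(M,n) = pTwo M n` (two distinct spanning clusters of `[0,M]×[0,n]`),
`f(M,b)` = the probability of c6's END-CONFINED block event `F(M,b)` on `[0,M]×[0,3b+2]` (written out as the lambda
`hf` below, byte-identical to `cg_f_supermul`), the two-cluster rates `γ₂(n)` and the Kac statement K₂ `n·γ₂(n) → 2π`.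

§1 (UNCONDITIONAL, assembling waves 1–2 of c8):
* `c8_rateConfined` — the confined event has the two-cluster RATE: `−log f(M,b)/M → γ₂(3b+2)` (transfer-matrix order;
  comparison `f(M+2(b+3),b) ≥ c(b)·p₂(M,3b+2)` by the docking structure of E₂ + deterministic end surgery,
  `c8_confinedOfPlain`, and `f ≤ p₂`);
* `confinedUpper_of_stripClusterRates` — NECESSITY of the confined Cardy-order UPPER bound (exponent `2π`).

§2 (MODULO END SEPARATION `SEP`: a plain two-cluster crossing can be upgraded to an end-confined one `k` widths longer at
bounded cost, uniformly in the mesh — the RSW-level residue, Kesten 1987 / Nolin 2008 §4 arm separation at a strip end):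
* `kacTwo_iff_cardyOrderTwo_of_sep` — K₂ ⟺ CO₂ (the registered open stub, plain upper / confined lower);
* `kacTwo_iff_plain_of_sep` — K₂ ⟺ PU ∧ PL (the PLAIN two-sided Cardy-order statement `e^(−G(A)) ≤ p₂(A n,n) ≤ e^(−g(A))`
  eventually in `n`, `g(A)/A, G(A)/A → 2π`);
* `stripClusterRates_iff_plain_of_sep` — **StripClusterRates ⟺ CO₁ ∧ PU ∧ PL**: modulo SEP the crux is EXACTLY the pair
  of Cardy-order strip Kac exponents `h_(1,3) = 1/3` (one cluster, two-sided) and `h_(1,5) = 2` (two clusters, two-sided,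
  plain events) — the form a conformal-invariance route delivers;
* `stripClusterRates_iff_cardyOrder_of_sep` — StripClusterRates ⟺ CO₁ ∧ CO₂ (both registered open stubs are then NECESSARY).

References: [Cardy1998] eq. (bb); [Nolin2008] §4 (separation, quasi-multiplicativity); [Kesten1987]; [Aizenman1997] Thm 3.
-/

noncomputable section

open MeasureTheory Filter Topology Set
open Literature.Probability.LatticeModels Literature.Probability.Percolation
open Summit.CriticalPhenomena.CardyFormulaZ2.Theorems.StripClusterRates.Negative (pOne pTwo rateSeqTwo rateSeqOne)

namespace Summit.CriticalPhenomena.CardyFormulaZ2.Cruxes.StripClusterRates.TwoClusterRateIsStationaryGap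

/-! ## §1 Unconditional consequences of waves 1–2 -/

/-- **The end-confined event has the two-cluster rate** (transfer-matrix order): for every `b ≥ 1` and every limit `γ` of
`−log p₂(M,3b+2)/M`, also `−log f(M,b)/M → γ`. [folklore] -/
theorem c8_rateConfined : ∀ f : ℕ → ℕ → ℝ, f = (fun M b : ℕ => (bondPercolation (zdGraph 2) half).real ((openCrossing {z ∈ (rectangle M (3 * b + 2) : Set (Site 2)) | (z 0 ≤ (b : ℤ) ∨ (M : ℤ) ≤ z 0 + b) → z 1 ≤ (b : ℤ)} (leftSide M (3 * b + 2) : Set (Site 2)) (rightSide M (3 * b + 2) : Set (Site 2)) ∩ tbCrossing b b ∩ openCrossing {z ∈ (rectangle M (3 * b + 2) : Set (Site 2)) | (z 0 ≤ (b : ℤ) ∨ (M : ℤ) ≤ z 0 + b) → 2 * (b : ℤ) + 2 ≤ z 1} (leftSide M (3 * b + 2) : Set (Site 2)) (rightSide M (3 * b + 2) : Set (Site 2)) ∩ (BondConfig.relabel (sym2Equiv (Site.shift (-pt 0 (2 * (b : ℤ) + 2))))) ⁻¹' tbCrossing b b) ∩ (dualConfig ⁻¹' openCrossing {z ∈ ((·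 + pt (-1) 0) '' (rectangle (M + 1) (3 * b + 1) : Set (Site 2))) | (z 0 ≤ (b : ℤ) ∨ (M : ℤ) ≤ z 0 + b) → (b : ℤ) + 1 ≤ z 1 ∧ z 1 ≤ 2 * (b : ℤ)} ((· + pt (-1) 0) '' (leftSide (M + 1) (3 * b + 1) : Set (Site 2))) ((· + pt (-1) 0) '' (rightSide (M + 1) (3 * b + 1) : Set (Site 2)))))) →
    ∀ b : ℕ, 1 ≤ b → ∀ γ : ℝ, Tendsto (rateSeqTwo (3 * b + 2)) atTop (𝓝 γ) →
      Tendsto (fun M : ℕ ↦ -Real.log (f M b) / (M : ℝ)) atTop (𝓝 γ) :=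
  fun f hf => c8_rateConfined_of_cmp f hf (c8_confinedOfPlain f hf)

/-- **Necessity of the confined Cardy-order upper bound**: the crux forces `f(A(3b+2), b) ≤ e^(−g(A))` eventually in `b`
with `g(A)/A → 2π`. [cite: Cardy1998, eq. (bb)] -/
theorem confinedUpper_of_stripClusterRates (f : ℕ → ℕ → ℝ) (hf : f = (fun M b : ℕ => (bondPercolation (zdGraph 2) half).real ((openCrossing {z ∈ (rectangle M (3 * b + 2) : Set (Site 2)) | (z 0 ≤ (b : ℤ) ∨ (M : ℤ) ≤ z 0 + b) → z 1 ≤ (b : ℤ)} (leftSide M (3 * b + 2) : Set (Site 2)) (rightSide M (3 * b + 2) : Set (Site 2)) ∩ tbCrossing b b ∩ openCrossing {z ∈ (rectangle M (3 * b + 2) : Set (Site 2)) | (z 0 ≤ (b : ℤ) ∨ (M : ℤ) ≤ z 0 + b) → 2 * (b : ℤ) + 2 ≤ z 1} (leftSide M (3 * b + 2) : Set (Site 2)) (rightSide M (3 * b + 2) : Set (Site 2)) ∩ (BondConfig.relabel (sym2Equiv (Site.shift (-pt 0 (2 * (b : ℤ) + 2))))) ⁻¹' tbCrossing b b) ∩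 (dualConfig ⁻¹' openCrossing {z ∈ ((· + pt (-1) 0) '' (rectangle (M + 1) (3 * b + 1) : Set (Site 2))) | (z 0 ≤ (b : ℤ) ∨ (M : ℤ) ≤ z 0 + b) → (b : ℤ) + 1 ≤ z 1 ∧ z 1 ≤ 2 * (b : ℤ)} ((· + pt (-1) 0) '' (leftSide (M + 1) (3 * b + 1) : Set (Site 2))) ((· + pt (-1) 0) '' (rightSide (M + 1) (3 * b + 1) : Set (Site 2)))))))
    (h : Summit.CriticalPhenomena.CardyFormulaZ2.Theses.CardyBoundaryCoulombGas.StripClusterRates) :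
    ∃ g : ℕ → ℝ, Tendsto (fun A : ℕ ↦ g A / A) atTop (𝓝 (2 * Real.pi)) ∧ ∀ A : ℕ, 1 ≤ A → ∀ᶠ b : ℕ in atTop,
      f (A * (3 * b + 2)) b ≤ Real.exp (-g A) := by
  obtain ⟨γ₁, γ₂, -, h₂, -, h₄⟩ := h
  exact c8_confinedUpper_of_kacTwo f hf γ₂ h₂ h₄

/-! ## §2 Modulo end separation -/

/-- A family of two-cluster rates (one limit per width `n ≥ 1`). [folklore] -/
theorem c8_exists_rateTwo_family : ∃ γ₂ : ℕ → ℝ, (∀ n : ℕ, 1 ≤ n → Tendsto (rateSeqTwo n) atTop (𝓝 (γ₂ n))) := by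
  classical
  refine ⟨fun n => if hn : 1 ≤ n then (Summit.CriticalPhenomena.CardyFormulaZ2.Theorems.StripRates.exists_rateTwo hn).choose else 0,
    fun n hn => ?_⟩
  simp only [dif_pos hn]
  exact (Summit.CriticalPhenomena.CardyFormulaZ2.Theorems.StripRates.exists_rateTwo hn).choose_spec

/-- **SEP ⟹ (K₂ ⟹ PU)**: end separation and the Kac limit give the PLAIN Cardy-order upper bound along all widths.
[cite: Nolin2008, §4] -/
theorem plainUpper_of_sep_kacTwo (f : ℕ → ℕ → ℝ) (hf : f = (fun M b : ℕ => (bondPercolation (zdGraph 2) half).real ((openCrossing {z ∈ (rectangle M (3 * b + 2) : Set (Site 2)) | (z 0 ≤ (b : ℤ) ∨ (M : ℤ) ≤ z 0 + b) → z 1 ≤ (b : ℤ)} (leftSide M (3 * b + 2) : Set (Site 2)) (rightSide M (3 * b + 2) : Set (Site 2)) ∩ tbCrossing b b ∩ openCrossing {z ∈ (rectangle M (3 * b + 2) : Set (Site 2)) | (z 0 ≤ (b : ℤ) ∨ (M : ℤ) ≤ z 0 + b) → 2 * (b : ℤ) + 2 ≤ z 1} (leftSide M (3 * b + 2) : Set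 (Site 2)) (rightSide M (3 * b + 2) : Set (Site 2)) ∩ (BondConfig.relabel (sym2Equiv (Site.shift (-pt 0 (2 * (b : ℤ) + 2))))) ⁻¹' tbCrossing b b) ∩ (dualConfig ⁻¹' openCrossing {z ∈ ((· + pt (-1) 0) '' (rectangle (M + 1) (3 * b + 1) : Set (Site 2))) | (z 0 ≤ (b : ℤ) ∨ (M : ℤ) ≤ z 0 + b) → (b : ℤ) + 1 ≤ z 1 ∧ z 1 ≤ 2 * (b : ℤ)} ((· + pt (-1) 0) '' (leftSide (M + 1) (3 * b + 1) : Set (Site 2))) ((· + pt (-1) 0) '' (rightSide (M + 1) (3 * b + 1) : Set (Site 2)))))))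
    (hsep : (∃ c : ℝ, 0 < c ∧ ∃ b₀ k : ℕ, 1 ≤ k ∧ ∀ b : ℕ, b₀ ≤ b → ∀ M : ℕ, 1 ≤ M → c * pTwo M (3 * b + 2) ≤ f (M + k * (3 * b + 2)) b)) :
    ∀ γ₂ : ℕ → ℝ, (∀ n : ℕ, 1 ≤ n → Tendsto (rateSeqTwo n) atTop (𝓝 (γ₂ n))) → Tendsto (fun n : ℕ ↦ (n : ℝ) * γ₂ n) atTop (𝓝 (2 * Real.pi)) → (∃ g : ℕ → ℝ, Tendsto (fun A : ℕ ↦ g A / A) atTop (𝓝 (2 * Real.pi)) ∧ ∀ A : ℕ, 1 ≤ A → ∀ᶠ n : ℕ in atTop, pTwo (A * n) n ≤ Real.exp (-g A)) :=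
  fun γ₂ h₂ hK => c8_plainUpper_of_uniform_kacTwo γ₂ h₂ hK (c8_uniformUpper_of_sep f hf hsep γ₂ h₂)

/-- **Modulo SEP, K₂ ⟺ CO₂** (the registered open stub: plain upper bound, confined lower bound).
[cite: Cardy1998, eq. (bb)] -/
theorem kacTwo_iff_cardyOrderTwo_of_sep (f : ℕ → ℕ → ℝ) (hf : f = (fun M b : ℕ => (bondPercolation (zdGraph 2) half).real ((openCrossing {z ∈ (rectangle M (3 * b + 2) : Set (Site 2)) | (z 0 ≤ (b : ℤ) ∨ (M : ℤ) ≤ z 0 + b) → z 1 ≤ (b : ℤ)} (leftSide M (3 * b + 2) : Set (Site 2)) (rightSide M (3 * b + 2) : Set (Site 2)) ∩ tbCrossing b b ∩ openCrossing {z ∈ (rectangle M (3 * b + 2) : Set (Site 2)) | (z 0 ≤ (b : ℤ) ∨ (M : ℤ) ≤ z 0 + b) → 2 * (b : ℤ) + 2 ≤ z 1} (leftSide M (3 * b + 2) : Set (Site 2)) (rightSide M (3 * b + 2) : Set (Site 2)) ∩ (BondConfig.relabel (sym2Equiv (Site.shift (-pt 0 (2 * (b : ℤ) + 2))))) ⁻¹'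 tbCrossing b b) ∩ (dualConfig ⁻¹' openCrossing {z ∈ ((· + pt (-1) 0) '' (rectangle (M + 1) (3 * b + 1) : Set (Site 2))) | (z 0 ≤ (b : ℤ) ∨ (M : ℤ) ≤ z 0 + b) → (b : ℤ) + 1 ≤ z 1 ∧ z 1 ≤ 2 * (b : ℤ)} ((· + pt (-1) 0) '' (leftSide (M + 1) (3 * b + 1) : Set (Site 2))) ((· + pt (-1) 0) '' (rightSide (M + 1) (3 * b + 1) : Set (Site 2)))))))
    (hsep : (∃ c : ℝ, 0 < c ∧ ∃ b₀ k : ℕ, 1 ≤ k ∧ ∀ b : ℕ, b₀ ≤ b → ∀ M : ℕ, 1 ≤ M → c * pTwo M (3 * b + 2) ≤ f (M + k * (3 * b + 2)) b)) :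
    (∀ γ₂ : ℕ → ℝ, (∀ n : ℕ, 1 ≤ n → Tendsto (rateSeqTwo n) atTop (𝓝 (γ₂ n))) → Tendsto (fun n : ℕ ↦ (n : ℝ) * γ₂ n) atTop (𝓝 (2 * Real.pi))) ↔ ((∃ g : ℕ → ℝ, Tendsto (fun A : ℕ ↦ g A / A) atTop (𝓝 (2 * Real.pi)) ∧ ∀ A : ℕ, 1 ≤ A → ∀ᶠ n : ℕ in atTop, pTwo (A * n) n ≤ Real.exp (-g A)) ∧ (∃ G : ℕ → ℝ, Tendsto (fun A : ℕ ↦ G A / A) atTop (𝓝 (2 * Real.pi)) ∧ ∀ A : ℕ, 1 ≤ A → ∀ᶠ b : ℕ in atTop, Real.exp (-G A) ≤ f (A * (3 * b + 2)) b)) := by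
  constructor
  · intro hK
    obtain ⟨γ₂, h₂⟩ := c8_exists_rateTwo_family
    exact ⟨plainUpper_of_sep_kacTwo f hf hsep γ₂ h₂ (hK γ₂ h₂),
      c8_confinedLower_of_sep_kacTwo f hf hsep (c8_confined_apriori_lower f hf) γ₂ h₂ (hK γ₂ h₂)⟩
  · rintro ⟨hPU, hCL⟩ γ₂ h₂
    subst hf
    exact tendsto_nMul_rateTwo_of_cardyOrderTwo ⟨hPU, hCL⟩ γ₂ h₂

/-- **Modulo SEP, K₂ ⟺ PU ∧ PL** (the PLAIN two-sided Cardy-order two-cluster statement). [cite: Cardy1998, eq. (bb)] -/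
theorem kacTwo_iff_plain_of_sep (f : ℕ → ℕ → ℝ) (hf : f = (fun M b : ℕ => (bondPercolation (zdGraph 2) half).real ((openCrossing {z ∈ (rectangle M (3 * b + 2) : Set (Site 2)) | (z 0 ≤ (b : ℤ) ∨ (M : ℤ) ≤ z 0 + b) → z 1 ≤ (b : ℤ)} (leftSide M (3 * b + 2) : Set (Site 2)) (rightSide M (3 * b + 2) : Set (Site 2)) ∩ tbCrossing b b ∩ openCrossing {z ∈ (rectangle M (3 * b + 2) : Set (Site 2)) | (z 0 ≤ (b : ℤ) ∨ (M : ℤ) ≤ z 0 + b) → 2 * (b : ℤ) + 2 ≤ z 1} (leftSide M (3 * b + 2) : Set (Site 2)) (rightSide M (3 * b + 2) : Set (Site 2)) ∩ (BondConfig.relabel (sym2Equiv (Site.shift (-pt 0 (2 * (b : ℤ) + 2))))) ⁻¹' tbCrossing b b) ∩ (dualConfig ⁻¹' openCrossing {z ∈ ((· + pt (-1) 0) '' (rectangle (M + 1) (3 * b + 1) : Set (Site 2))) | (z 0 ≤ (b : ℤ) ∨ (M : ℤ) ≤ z 0 + b) → (b : ℤ) + 1 ≤ z 1 ∧ z 1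 ≤ 2 * (b : ℤ)} ((· + pt (-1) 0) '' (leftSide (M + 1) (3 * b + 1) : Set (Site 2))) ((· + pt (-1) 0) '' (rightSide (M + 1) (3 * b + 1) : Set (Site 2)))))))
    (hsep : (∃ c : ℝ, 0 < c ∧ ∃ b₀ k : ℕ, 1 ≤ k ∧ ∀ b : ℕ, b₀ ≤ b → ∀ M : ℕ, 1 ≤ M → c * pTwo M (3 * b + 2) ≤ f (M + k * (3 * b + 2)) b)) :
    (∀ γ₂ : ℕ → ℝ, (∀ n : ℕ, 1 ≤ n → Tendsto (rateSeqTwo n) atTop (𝓝 (γ₂ n))) → Tendsto (fun n : ℕ ↦ (n : ℝ) * γ₂ n) atTop (𝓝 (2 * Real.pi))) ↔ ((∃ g : ℕ → ℝ, Tendsto (fun A : ℕ ↦ g A / A) atTop (𝓝 (2 * Real.pi)) ∧ ∀ A : ℕ, 1 ≤ A → ∀ᶠ n : ℕ in atTop, pTwo (A * n) n ≤ Real.exp (-g A)) ∧ (∃ G : ℕ → ℝ, Tendsto (fun A : ℕ ↦ G A / A) atTop (𝓝 (2 * Real.pi)) ∧ ∀ A : ℕ, 1 ≤ A → ∀ᶠ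 n : ℕ in atTop, Real.exp (-G A) ≤ pTwo (A * n) n)) := by
  constructor
  · intro hK
    obtain ⟨γ₂, h₂⟩ := c8_exists_rateTwo_family
    exact ⟨plainUpper_of_sep_kacTwo f hf hsep γ₂ h₂ (hK γ₂ h₂), co_cardyOrderTwoLower_of_kacTwo γ₂ h₂ (hK γ₂ h₂)⟩
  · rintro ⟨hPU, hPL⟩ γ₂ h₂
    exact c8_kacTwo_of_sep_plain f hf hsep (c8_confined_apriori_lower f hf) hPU hPL γ₂ h₂

/-- **Modulo SEP, the crux is exactly CO₁ ∧ PU ∧ PL** — the two Cardy-order strip Kac exponents `h_(1,3) = 1/3` and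
`h_(1,5) = 2`, both two-sided statements about PLAIN crossing events. [cite: Cardy1998, eq. (bb)] -/
theorem stripClusterRates_iff_plain_of_sep : ∀ f : ℕ → ℕ → ℝ, f = (fun M b : ℕ => (bondPercolation (zdGraph 2) half).real ((openCrossing {z ∈ (rectangle M (3 * b + 2) : Set (Site 2)) | (z 0 ≤ (b : ℤ) ∨ (M : ℤ) ≤ z 0 + b) → z 1 ≤ (b : ℤ)} (leftSide M (3 * b + 2) : Set (Site 2)) (rightSide M (3 * b + 2) : Set (Site 2)) ∩ tbCrossing b b ∩ openCrossing {z ∈ (rectangle M (3 * b + 2) : Set (Site 2)) | (z 0 ≤ (b : ℤ) ∨ (M : ℤ) ≤ z 0 + b) → 2 * (b : ℤ) + 2 ≤ z 1} (leftSide M (3 * b + 2) : Set (Site 2)) (rightSide M (3 * b + 2) : Set (Site 2)) ∩ (BondConfig.relabel (sym2Equiv (Site.shift (-pt 0 (2 * (b : ℤ) + 2))))) ⁻¹' tbCrossing b b) ∩ (dualConfig ⁻¹' openCrossing {z ∈ ((· + pt (-1) 0) '' (rectangle (M + 1) (3 * b + 1) : Set (Site 2))) | (z 0 ≤ (b : ℤ)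 ∨ (M : ℤ) ≤ z 0 + b) → (b : ℤ) + 1 ≤ z 1 ∧ z 1 ≤ 2 * (b : ℤ)} ((· + pt (-1) 0) '' (leftSide (M + 1) (3 * b + 1) : Set (Site 2))) ((· + pt (-1) 0) '' (rightSide (M + 1) (3 * b + 1) : Set (Site 2)))))) → (∃ c : ℝ, 0 < c ∧ ∃ b₀ k : ℕ, 1 ≤ k ∧ ∀ b : ℕ, b₀ ≤ b → ∀ M : ℕ, 1 ≤ M → c * pTwo M (3 * b + 2) ≤ f (M + k * (3 * b + 2)) b) → (Summit.CriticalPhenomena.CardyFormulaZ2.Theses.CardyBoundaryCoulombGas.StripClusterRates ↔ ((∃ g G : ℕ → ℝ, Tendsto (fun A : ℕ ↦ g A / A) atTop (𝓝 (Real.pi / 3)) ∧ Tendsto (fun A : ℕ ↦ G A / A) atTop (𝓝 (Real.pi / 3)) ∧ ∀ A : ℕ, 1 ≤ A → ∀ᶠ n : ℕ in atTop, Real.exp (-G A) ≤ crossingProb half (A * n) n ∧ crossingProb half (A * n) n ≤ Real.exp (-g A)) ∧ (∃ g : ℕ → ℝ, Tendsto (fun A : ℕ ↦ g A / A) atTop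 (𝓝 (2 * Real.pi)) ∧ ∀ A : ℕ, 1 ≤ A → ∀ᶠ n : ℕ in atTop, pTwo (A * n) n ≤ Real.exp (-g A)) ∧ (∃ G : ℕ → ℝ, Tendsto (fun A : ℕ ↦ G A / A) atTop (𝓝 (2 * Real.pi)) ∧ ∀ A : ℕ, 1 ≤ A → ∀ᶠ n : ℕ in atTop, Real.exp (-G A) ≤ pTwo (A * n) n))) := by
  intro f hf hsep
  constructor
  · intro h
    refine ⟨cardyOrderOne_of_stripClusterRates h, ?_, cardyOrderTwoLower_of_stripClusterRates h⟩
    obtain ⟨γ₁, γ₂, -, h₂, -, h₄⟩ := h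
    exact plainUpper_of_sep_kacTwo f hf hsep γ₂ h₂ h₄
  · rintro ⟨hCO₁, hPU, hPL⟩
    exact stripClusterRates_of_cardyOrderOne_of_kacTwo hCO₁
      (twoClusterKac_iff_kacTwo.1 fun γ₂ h₂ => c8_kacTwo_of_sep_plain f hf hsep (c8_confined_apriori_lower f hf) hPU hPL γ₂ h₂)

/-- **Modulo SEP, the crux is exactly CO₁ ∧ CO₂** (both registered open stubs of the skeleton become necessary).
[cite: Cardy1998, eq. (bb)] -/
theorem stripClusterRates_iff_cardyOrder_of_sep (f : ℕ → ℕ → ℝ) (hf : f = (fun M b : ℕ => (bondPercolation (zdGraph 2) half).real ((openCrossing {z ∈ (rectangle M (3 * b + 2) : Set (Site 2)) | (z 0 ≤ (b : ℤ) ∨ (M : ℤ) ≤ z 0 + b) → z 1 ≤ (b : ℤ)} (leftSide M (3 * b + 2) : Set (Site 2)) (rightSide M (3 * b + 2) : Set (Site 2)) ∩ tbCrossing b b ∩ openCrossing {z ∈ (rectangle M (3 * b + 2) : Set (Site 2)) | (z 0 ≤ (b : ℤ) ∨ (M : ℤ) ≤ z 0 + b) → 2 * (b : ℤ) + 2 ≤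 z 1} (leftSide M (3 * b + 2) : Set (Site 2)) (rightSide M (3 * b + 2) : Set (Site 2)) ∩ (BondConfig.relabel (sym2Equiv (Site.shift (-pt 0 (2 * (b : ℤ) + 2))))) ⁻¹' tbCrossing b b) ∩ (dualConfig ⁻¹' openCrossing {z ∈ ((· + pt (-1) 0) '' (rectangle (M + 1) (3 * b + 1) : Set (Site 2))) | (z 0 ≤ (b : ℤ) ∨ (M : ℤ) ≤ z 0 + b) → (b : ℤ) + 1 ≤ z 1 ∧ z 1 ≤ 2 * (b : ℤ)} ((· + pt (-1) 0) '' (leftSide (M + 1) (3 * b + 1) : Set (Site 2))) ((· + pt (-1) 0) '' (rightSide (M + 1) (3 * b + 1) : Set (Site 2)))))))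
    (hsep : (∃ c : ℝ, 0 < c ∧ ∃ b₀ k : ℕ, 1 ≤ k ∧ ∀ b : ℕ, b₀ ≤ b → ∀ M : ℕ, 1 ≤ M → c * pTwo M (3 * b + 2) ≤ f (M + k * (3 * b + 2)) b)) :
    Summit.CriticalPhenomena.CardyFormulaZ2.Theses.CardyBoundaryCoulombGas.StripClusterRates ↔ ((∃ g G : ℕ → ℝ, Tendsto (fun A : ℕ ↦ g A / A) atTop (𝓝 (Real.pi / 3)) ∧ Tendsto (fun A : ℕ ↦ G A / A) atTop (𝓝 (Real.pi / 3)) ∧ ∀ A : ℕ, 1 ≤ A → ∀ᶠ n : ℕ in atTop, Real.exp (-G A) ≤ crossingProb half (A * n) n ∧ crossingProb half (A * n) n ≤ Real.exp (-g A)) ∧ (∃ g : ℕ → ℝ, Tendsto (fun A : ℕ ↦ g A / A) atTop (𝓝 (2 * Real.pi)) ∧ ∀ A : ℕ, 1 ≤ A → ∀ᶠ n : ℕ in atTop, (bondPercolation (zdGraph 2) half).real {ω | ∃ x₁ ∈ (leftSide (A * n) n : Set (Site 2)), ∃ y₁ ∈ (rightSide (A * n) n : Set (Site 2)), ∃ x₂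 ∈ (leftSide (A * n) n : Set (Site 2)), ∃ y₂ ∈ (rightSide (A * n) n : Set (Site 2)), ω ∈ openConnIn (rectangle (A * n) n : Set (Site 2)) x₁ y₁ ∧ ω ∈ openConnIn (rectangle (A * n) n : Set (Site 2)) x₂ y₂ ∧ ω ∉ openConnIn (rectangle (A * n) n : Set (Site 2)) x₁ x₂} ≤ Real.exp (-g A)) ∧ (∃ G : ℕ → ℝ, Tendsto (fun A : ℕ ↦ G A / A) atTop (𝓝 (2 * Real.pi)) ∧ ∀ A : ℕ, 1 ≤ A → ∀ᶠ b : ℕ in atTop, Real.exp (-G A) ≤ (bondPercolation (zdGraph 2) half).real ((openCrossing {z ∈ (rectangle (A * (3 * b + 2) : ℕ) (3 * b + 2) : Set (Site 2)) | (z 0 ≤ (b : ℤ) ∨ ((A * (3 * b + 2) : ℕ) : ℤ) ≤ z 0 + b) → z 1 ≤ (b : ℤ)} (leftSide (A * (3 * b + 2) : ℕ) (3 * b + 2) : Set (Site 2)) (rightSide (A * (3 * b + 2) : ℕ) (3 * b + 2) : Set (Site 2)) ∩ tbCrossing b b ∩ openCrossing {z ∈ (rectangle (A * (3 * b + 2)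 : ℕ) (3 * b + 2) : Set (Site 2)) | (z 0 ≤ (b : ℤ) ∨ ((A * (3 * b + 2) : ℕ) : ℤ) ≤ z 0 + b) → 2 * (b : ℤ) + 2 ≤ z 1} (leftSide (A * (3 * b + 2) : ℕ) (3 * b + 2) : Set (Site 2)) (rightSide (A * (3 * b + 2) : ℕ) (3 * b + 2) : Set (Site 2)) ∩ (BondConfig.relabel (sym2Equiv (Site.shift (-pt 0 (2 * (b : ℤ) + 2))))) ⁻¹' tbCrossing b b) ∩ (dualConfig ⁻¹' openCrossing {z ∈ ((· + pt (-1) 0) '' (rectangle ((A * (3 * b + 2) : ℕ) + 1) (3 * b + 1) : Set (Site 2))) | (z 0 ≤ (b : ℤ) ∨ ((A * (3 * b + 2) : ℕ) : ℤ) ≤ z 0 + b) → (b : ℤ) + 1 ≤ z 1 ∧ z 1 ≤ 2 * (b : ℤ)} ((· + pt (-1) 0) '' (leftSide ((A * (3 * b + 2) : ℕ) + 1) (3 * b + 1) : Set (Site 2))) ((· + pt (-1) 0) '' (rightSide ((A * (3 * b + 2) : ℕ) + 1) (3 * b + 1) : Set (Site 2))))))) := by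
  have hiff := kacTwo_iff_cardyOrderTwo_of_sep f hf hsep
  subst hf
  constructor
  · intro h
    refine ⟨cardyOrderOne_of_stripClusterRates h, ?_⟩
    exact hiff.1 (twoClusterKac_iff_kacTwo.2 fun s hs => kacTwo_of_stripClusterRates h s hs)
  · rintro ⟨hCO₁, hCO₂⟩
    exact stripClusterRates_of_cardyOrderOne_of_cardyOrderTwo hCO₁ hCO₂

end Summit.CriticalPhenomena.CardyFormulaZ2.Cruxes.StripClusterRates.TwoClusterRateIsStationaryGap

end
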